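import Mathlib
import Summits.Ventures.PercRepro2.Defs
import Summits.Ventures.PercRepro2.Independence
import Summits.Ventures.PercRepro2.Harris
import Summits.Ventures.PercRepro2.Graph
import Summits.Ventures.PercRepro2.Exploration
import Summits.Ventures.PercRepro2.Events
import Summits.Ventures.PercRepro2.FourFunctions
import Summits.Ventures.PercRepro2.Induced
import Summits.Ventures.PercRepro2.Frontier
import Summits.Ventures.PercRepro2.ObsIndependence
import Summits.Ventures.PercRepro2.BHK
import Summits.Ventures.PercRepro2.BHKEvents
import Summits.Ventures.PercRepro2.OrderPreservation
import Summits.Ventures.PercRepro2.BHKAvoid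
import Summits.Ventures.PercRepro2.SameClusterAvoid
import Summits.Ventures.PercRepro2.CaseOneRegime
import Summits.Ventures.PercRepro2.CaseOnePos
import Summits.Ventures.PercRepro2.CaseOneJ11
import Summits.Ventures.PercRepro2.CaseOneRV
import Summits.Ventures.PercRepro2.CaseOnePendant
import Summits.Ventures.PercRepro2.CaseOnePendantAny
import Summits.Ventures.PercRepro2.CaseOnePendantNec
import Summits.Ventures.PercRepro2.HullDefs
import Summits.Ventures.PercRepro2.OneEdge
import Summits.Ventures.PercRepro2.StarPattern
import Summits.Ventures.PercRepro2.HCov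
import Summits.Ventures.PercRepro2.HCovSwap
import Summits.Ventures.PercRepro2.OddsLemma
import Summits.Ventures.PercRepro2.RV
import Summits.Ventures.PercRepro2.RVBridge
import Summits.Ventures.PercRepro2.CaseOneDWorld
import Summits.Ventures.PercRepro2.CaseOneDWorldPin
import Summits.Ventures.PercRepro2.CaseOneDWorldEdge
import Summits.Ventures.PercRepro2.CaseOneDWorldLeaf
import Summits.Ventures.PercRepro2.CaseOneDWorldOdds

/-!
# THEOREM D2 — the degree-2 reduction of the case-1 rung (blind cell PercRepro2, p1 g14; S5 §2.1
(K9), proofs/P1-DWORLD.md §3)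

Let `a₃` have exactly two edges, `e₁ = {a₁, a₃}` and `e₀ = {v, a₃}` with `v ∉ {a₁, a₂}`
(`IsDegTwoAt`; `o, b ≠ a₃`). In the D-world the root edge is free (`zSplitIID_of_a1_edge`), after
which `a₃` is a leaf at `v` in the support (`isLeafSupp_of_degTwo`), and the pendant identity (L)
reduces `a₃` to `v` (`zSplitIID_of_leaf_supp`, CaseOneDWorldOdds.lean). Hence

  **`zSplitII_of_degTwo`**: if the D-world `(ii)` of `v` in `G − a₃` (weights `p[e₁ ↦ 0][e₀ ↦ 0]`)
  holds at the PD pair `(D_o(a₃), D(a₃))` of `a₃`, then `(ii)` holds for `a₃`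

— the «first open structural class» of S5 §2.3 («a₃ of degree ≥ 2 after the reductions, e.g. adjacent
to a₁ and one more vertex») is settled by the neighbour. The two marked neighbours are unconditional:
**`zSplitII_of_degTwo_o`** (`v = o`) and **`zSplitII_of_degTwo_b`** (`v = b`; the threshold condition is
the odds condition at the mixed pair), and so is a root-only neighbour by the same route. The
hypothesis is NOT automatic in general (the D-world `(ii)` at the PD threshold fails on 5 / 1,250,160
instances at n = 6 — P1-DWORLD.md §4), so for an unmarked `v` this is a reduction, not a proof.
Own code; standard axioms.
-/

namespace Summit.Ventures.PercRepro2

namespace CaseOne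

section DegTwo
variable {V : Type*} {E : Type*} [DecidableEq E]

/-- **`a₃` is of degree two, adjacent to `a₁` and to `v`**: `e₁ = {a₁, a₃}` and `e₀ = {v, a₃}` are
its only edges. -/
structure IsDegTwoAt (ends : E → Sym2 V) (a₁ v a₃ : V) (e₁ e₀ : E) : Prop where
  /-- the root edge -/
  ends₁ : ends e₁ = s(a₁, a₃)
  /-- the edge to `v` -/
  ends₀ : ends e₀ = s(v, a₃)
  /-- two different edges -/
  ne : e₁ ≠ e₀
  /-- no other edge at `a₃` -/
  unique : ∀ e, a₃ ∈ ends e → e = e₁ ∨ e = e₀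
  /-- `a₁` is not `a₃` -/
  ne_1 : a₁ ≠ a₃
  /-- `v` is not `a₃` -/
  ne_v : v ≠ a₃

variable {R : Type*} [CommRing R]

/-- After pinning the root edge closed, `a₃` is a leaf at `v` in the support. -/
lemma isLeafSupp_of_degTwo (p : E → R) {ends : E → Sym2 V} {a₁ v a₃ : V} {e₁ e₀ : E}
    (h : IsDegTwoAt ends a₁ v a₃ e₁ e₀) :
    IsLeafSupp (Function.update p e₁ 0) ends v a₃ e₀ where
  ends_eq := h.ends₀
  null := fun e he hne => by
    rcases h.unique e he with rfl | rfl
    · simp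
    · exact absurd rfl hne
  ne := h.ne_v

end DegTwo

section Theorem
variable {V : Type*} {E : Type*} [Fintype E] [DecidableEq E] [Fintype V] [DecidableEq V]
  {R : Type*} [Field R] [LinearOrder R] [IsStrictOrderedRing R]
variable {p : E → R} {ends : E → Sym2 V} {a₁ v a₃ : V} {e₁ e₀ : E}

/-- **Theorem D2, D-world form**: the D-world `(ii)` of `v` in `G − a₃` (weights
`p[e₁ ↦ 0][e₀ ↦ 0]`) at the PD pair of `a₃` gives the D-world `(ii)` of `a₃`. -/
theorem zSplitIID_of_degTwo (hp : IsProbVec p) (h : IsDegTwoAt ends a₁ v a₃ e₁ e₀) {o a₂ b : V}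
    (ho : o ≠ a₃) (h2 : a₂ ≠ a₃) (hb : b ≠ a₃)
    (hv : 0 ≤ iiExprD (Function.update (Function.update p e₁ 0) e₀ 0) ends o a₁ a₂ v b
      (Dpdo p ends o a₁ a₂ a₃) (Dpd p ends a₁ a₂ a₃)) :
    ZSplitIID p ends o a₁ a₂ a₃ b := by
  have hp0 : IsProbVec (Function.update p e₁ 0) := hp.update e₁ le_rfl zero_le_one
  have hl := isLeafSupp_of_degTwo p h
  rw [Dpd_a1_edge p h.ends₁, Dpdo_a1_edge p h.ends₁ o, iiExprD_smul] at hv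
  rcases (sub_nonneg.mpr (hp.le_one e₁)).lt_or_eq with hlt | heq
  · -- `p₁ < 1`: divide by `1 − p₁`, then the root-edge and the pendant steps
    have hv' := nonneg_of_mul_nonneg_right hv hlt
    exact zSplitIID_of_a1_edge p hp h.ends₁ o b
      (zSplitIID_of_leaf_supp hp0 hl ho h.ne_1 h2 hb hv')
  · -- `p₁ = 1`: the PD pair of `a₃` vanishes and so does `iiExprD`
    unfold ZSplitIID
    rw [Dpd_a1_edge p h.ends₁, Dpdo_a1_edge p h.ends₁ o, ← heq, zero_mul, zero_mul, iiExprD_eq]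
    simp

/-- **Theorem D2**: `(ii)` for a degree-two `a₃` adjacent to `a₁` and `v`, from the D-world `(ii)` of
`v` in `G − a₃` at the PD pair of `a₃`. -/
theorem zSplitII_of_degTwo (hp : IsProbVec p) (h : IsDegTwoAt ends a₁ v a₃ e₁ e₀) {o a₂ b : V}
    (ho : o ≠ a₃) (h2 : a₂ ≠ a₃) (hb : b ≠ a₃)
    (hv : 0 ≤ iiExprD (Function.update (Function.update p e₁ 0) e₀ 0) ends o a₁ a₂ v b
      (Dpdo p ends o a₁ a₂ a₃) (Dpd p ends a₁ a₂ a₃)) :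
    ZSplitII p ends o a₁ a₂ a₃ b :=
  zSplitII_of_dworld p hp ends o a₁ a₂ a₃ b (zSplitIID_of_degTwo hp h ho h2 hb hv)

/-- **`(ii)` for `a₃` adjacent only to `a₁` and `o`** (unconditional). -/
theorem zSplitII_of_degTwo_o (hp : IsProbVec p) {o : V} (h : IsDegTwoAt ends a₁ o a₃ e₁ e₀)
    {a₂ b : V} (h2 : a₂ ≠ a₃) (hb : b ≠ a₃) : ZSplitII p ends o a₁ a₂ a₃ b :=
  zSplitII_of_degTwo hp h h.ne_v h2 hb
    (iiExprD_nonneg_of_a3_eq_o _ ((hp.update e₁ le_rfl zero_le_one).update e₀ le_rfl zero_le_one)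
      ends o a₁ a₂ b _ _ (prob_nonneg hp _))

/-- **`(ii)` for `a₃` adjacent only to `a₁` and `b`** (unconditional): the threshold condition at the
PD pair of `a₃` is the odds condition at a mixture of the Q pair and the PD pair of `b`. -/
theorem zSplitII_of_degTwo_b (hp : IsProbVec p) {b : V} (h : IsDegTwoAt ends a₁ b a₃ e₁ e₀)
    {o a₂ : V} (ho : o ≠ a₃) (h2 : a₂ ≠ a₃) : ZSplitII p ends o a₁ a₂ a₃ b := by
  refine zSplitII_of_degTwo hp h ho h2 h.ne_v ?_
  have hp0 : IsProbVec (Function.update p e₁ 0) := hp.update e₁ le_rfl zero_le_one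
  have hp00 : IsProbVec (Function.update (Function.update p e₁ 0) e₀ 0) :=
    hp0.update e₀ le_rfl zero_le_one
  have hl := isLeafSupp_of_degTwo p h
  refine iiExprD_nonneg_of_a3_eq_b _ hp00 ends o a₁ a₂ b _ _ ?_
  rw [Dpd_a1_edge p h.ends₁, Dpdo_a1_edge p h.ends₁ o, Dpd_leaf_supp hl h.ne_1 h2,
    Dpdo_leaf_supp hl ho h.ne_1 h2]
  have hr0 : 0 ≤ Function.update p e₁ 0 e₀ := hp0.nonneg e₀
  have hr1 : Function.update p e₁ 0 e₀ ≤ 1 := hp0.le_one e₀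
  have hodds := odds_mix (Function.update (Function.update p e₁ 0) e₀ 0) hp00 ends o a₁ a₂ b
    (Function.update p e₁ 0 e₀) hr0 hr1
  have h1 : 0 ≤ 1 - p e₁ := sub_nonneg.mpr (hp.le_one e₁)
  nlinarith [hodds, h1]

/-- **`(RV)` for `a₃` adjacent only to `a₁` and `o`** (when the required-vertex world has mass). -/
theorem rv_of_degTwo_o (hp : IsProbVec p) {o : V} (h : IsDegTwoAt ends a₁ o a₃ e₁ e₀)
    {a₂ b : V} (h2 : a₂ ≠ a₃) (hb : b ≠ a₃) (hT : 0 < prob p (Tp ends a₁ a₂ a₃)) :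
    RV p ends o a₁ a₂ a₃ b :=
  (rv_iff_ii p ends o a₁ a₂ a₃ b hT).2 (zSplitII_of_degTwo_o hp h h2 hb)

/-- **`(RV)` for `a₃` adjacent only to `a₁` and `b`** (when the required-vertex world has mass). -/
theorem rv_of_degTwo_b (hp : IsProbVec p) {b : V} (h : IsDegTwoAt ends a₁ b a₃ e₁ e₀)
    {o a₂ : V} (ho : o ≠ a₃) (h2 : a₂ ≠ a₃) (hT : 0 < prob p (Tp ends a₁ a₂ a₃)) :
    RV p ends o a₁ a₂ a₃ b :=
  (rv_iff_ii p ends o a₁ a₂ a₃ b hT).2 (zSplitII_of_degTwo_b hp h ho h2)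

end Theorem

end CaseOne

end Summit.Ventures.PercRepro2
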